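import Summits.ResolutionOfSingularities.ResolutionOfSingularities.Theorems.HilbertSamuelEliminationSigmaMaxModificationsCorridor3WLadderStrataBirthsTopDictionary
import HarnessLib

/-!
# [OURS · L1 W4.2] `Corridor3WLadderIsoTransitionBirthDefs` — the ISO → NON-ISO TRANSITION event («iso point birth») and the
# no-recurrence claim D17 (ii)

Crux chain w42 (`SigmaMaxModifications`, stmt-ResolutionOfSingularities-18506; conjunct stmt-ResolutionOfSingularities-19249), object D17
(ii)+(iii) (res-L1-w42-plan-1 RULINGS v3.13-1 (AJ) 09:02:58Z → res-type-067: «TYPING `def NoRecurrentIsoPointBirth3 (p) (Q)` [OURS claim,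
conjecture-tagged] + `wtopAltM_of_noRecurrentIsoPointBirth3` … file `…Corridor3WLadderIsoTransitionBirthDefs.lean`»), with the EVENT re-keyed per
res-L1-type-o1's VACUITY NOTE 09:02:43Z/09:06:52Z (adopted 09:07:17Z): at an ISOLATED stage `x_m` (`Moving.Iso`), `{x_m}` is itself a component of
`X_m(ν)`, so the non-domination clause of `IsNewbornAt` fails for every component collapsing to `x_m` and `IsFibreBirthAt` (part 1, p513551 —
the event of row (b-end)₃ on NEVER-isolated chains) is EMPTY there; the transition event therefore drops that clause. Typer res-type-067 (gen 11).
OURS (cell res-hironaka, slot W4.2); NOT statements of H. Hironaka's manuscript [Hironaka2017] nor of [CossartJannsenSaito2020]; AI-typed, weaker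
than expert review. Helper file `--supports stmt-ResolutionOfSingularities-19249 --as helper` (counted 0). This part: the two `def`s; part (iii)
`wtopAltM_of_noRecurrentIsoPointBirth3` (logic over res-type-012's D16 `WtopAltM`) follows as a sibling proof file once D16's Defs land.

* `IsIsoPointBirthAt N ν s s' f Z'` — `x_n` is ISOLATED in the HS-max locus of its stage, and `Z'` is an irreducible component of `X_{n+1}(ν)`
  through `x_{n+1}` lying in the fibre over `x_n` (image closure `{x_n}`) and not reduced to `{x_{n+1}}`: «after the point blow-up of the isolated
  `x_n`, a positive-dimensional component of the stratum through `x_{n+1}` inside `ℙ(Dir_{x_n})`» — the iso → non-iso TRANSITION (D17 (i), target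
  of res-type-053-successor / res-type-050: `Iso N s → ¬ Iso N s' → ∃ Z', IsIsoPointBirthAt N ν s s' f Z'` along a canonical near step).
* `NoRecurrentIsoPointBirth3 p Q` — OURS CLAIM (conjecture-tagged): along every moving W-top chain (`3 ≤ ē` at every stage, blown up infinitely
  often) from a `Q`-maximal origin, iso → non-iso transitions happen only finitely often. WHY IT MIGHT FAIL: a chain alternating for ever between
  isolated stages and curve-stratum stages (each point blow-up of an isolated E3 point giving birth to a near curve that is later resolved back to
  an isolated point); tri-1's bench specimens (T₇/T_d, F23b) are the first tests. Consumer: res-type-012's D16 `WtopAltM` via part (iii).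
-/

noncomputable section

set_option linter.dupNamespace false

open CategoryTheory AlgebraicGeometry TopologicalSpace Topology
open Summit.ResolutionOfSingularities.ResolutionOfSingularities.Theorems.CampaignW42
open Literature.AlgebraicGeometry.Resolution Literature.RingTheory.HilbertSamuel
open Summit.ResolutionOfSingularities.ResolutionOfSingularities.Theorems.SigmaMaxModificationsCorridor3

namespace Summit.ResolutionOfSingularities.ResolutionOfSingularities.Theorems.SigmaMaxModificationsCorridor3.Moving

universe u

/-- [OURS · L1 W4.2] **ISO POINT BIRTH at a step** (the iso → non-iso transition event, res-L1-type-o1's re-keying adopted): `x_n` is isolated in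
the HS-max locus of `X_n` (`Iso N s`), and `Z'` is an irreducible component of `X_{n+1}(ν)` through `x_{n+1}` lying in the fibre over `x_n`
(`closure (f '' Z') = {x_n}`) and different from `{x_{n+1}}`. No non-domination clause (at an isolated stage `{x_n}` IS a component of `X_n(ν)`, so
`IsNewbornAt`/`IsFibreBirthAt` would be empty — o1's `Moving.not_isFibreBirthAt_of_iso`). NOT a statement of any manuscript. [folklore] -/
def IsIsoPointBirthAt (N : ℕ) (ν : ℕ → ℕ) (s s' : MarkedStage.{u}) (f : s'.W ⟶ s.W) (Z' : Set s'.W) : Prop :=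
  Iso N s ∧ Z' ∈ componentsThrough N ν s' ∧ closure (f.base '' Z') = {s.pt} ∧ Z' ≠ {s'.pt}

/-- [OURS · L1 W4.2] **NO RECURRENT ISO POINT BIRTHS** (D17 (ii); OURS CLAIM, conjecture-tagged — nothing in print or in the tree proves it): for
every functional admissible oracle, value `ν`, `Q`-maximal origin of characteristic `p` at level `3` and every MOVING W-top chain from it
(`3 ≤ ē` at every stage, blown up infinitely often), from some stage on no step carries an iso point birth through the chain point — the chain
stops alternating between isolated and non-isolated stages through births in `ℙ(Dir)`. Refutable by ONE chain with infinitely many iso → non-iso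
transitions. NOT a statement of any manuscript. -/
def NoRecurrentIsoPointBirth3 (p : ℕ) (Q : ℕ → (ℕ → ℕ) → ∀ X : Scheme.{u}, X → Prop) : Prop :=
  ∀ (R : ∀ S : Scheme.{u}, CentreSeq S → Prop), OracleFunctional R → OracleAdmissible R →
  ∀ (ν : ℕ → ℕ) (X : Scheme.{u}) [IsLocallyNoetherian X] (x : X), IsMaximalOrigin p 3 ν X x → Q 3 ν X x →
  ∀ c : ℕ → MarkedStage.{u}, Reaches R 3 ν (MarkedStage.init X x) (c 0) →
    (∀ n, CanonicalNearStep R 3 ν (c n) (c (n + 1))) → (∀ n, 3 ≤ (c n).geomDirDim) →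
    (∀ n, ∃ m, n ≤ m ∧ (c m).IsBlownUp R 3 ν) →
    ∃ n₁, ∀ n, n₁ ≤ n → ∀ f : (c (n + 1)).W ⟶ (c n).W, StepProjection R 3 ν (c n) (c (n + 1)) f →
      ∀ Z', ¬ IsIsoPointBirthAt 3 ν (c n) (c (n + 1)) f Z'

end Summit.ResolutionOfSingularities.ResolutionOfSingularities.Theorems.SigmaMaxModificationsCorridor3.Moving

end
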